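import Literature.MathematicalPhysics.QuantumFieldTheory.Balaban1983to89.B6HBDisplacementLipV1
import Literature.MathematicalPhysics.QuantumFieldTheory.Balaban1983to89.B6HolderPairMemberV1
import Literature.MathematicalPhysics.QuantumFieldTheory.Balaban1983to89.B6Prop26KLevelSkeletonV2

/-!
# `Balaban1983to89.B6HolderLegPairTermsV1` — T. Bałaban, *Propagators and renormalization transformations for lattice gauge theories. II*,
# Commun. Math. Phys. **96** (1984) 223–250 [Balaban1984PropagatorsII], Prop. 2.6 (2.137) p. 247 with (2.141) p. 247 and (2.92) p. 239 line 1: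
# THE HÖLDER FIRST LEG OF (2.141) FOR `∇_νG`, PER CUBE, FROM THE PAIR MAJORANTS OF THE MEMBER — for a pair of fine bonds `x, x′` (same
# direction) the pair difference of `∇_ν(h_□G_□h_□)μ` splits by the product rule at TWO points into four terms,
# `(S_νh_□)(x′)·[E G_□ h_□μ](x) − [⋯](x′)`, `((S_νh_□)(x) − (S_νh_□)(x′))·[E G_□h_□μ](x)`, `(∇_νh_□)(x′)·([G_□h_□μ](x) − [⋯](x′))`,
# `((∇_νh_□)(x) − (∇_νh_□)(x′))·[G_□h_□μ](x)`; THIS FILE bounds their sum by **`1_{□̃}(y)·L²(τ_A + C1F·τ_C + σ·C₀)·(L^{j(y)}|c′|⁻¹)·e^{−ρd_T}`**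
# given the two PAIR majorants of the member on the global torus (`τ_A`, `τ_C`: the Hölder smallness `C_H t^α`, `C_H t` of `…B6CubeHolderInDecayV1`)
# — the single-point majorants (r03's `hEGin_cube`/`hGin_cube`), the sizes of `h_□`, `∇_νh_□` along the displacement (`σ = (d+1)|x − x′|_∞/(8S/5)`,
# `…B6HBDisplacementLipV1`) and the output localisation in `□̃` being supplied here

statement-level skeleton of published theorems with citation tags; proofs where landed; nothing here is a claim about the Yang–Mills mass gap

PDF held: `paper:balaban1984-cmp96-propagators-rt-ii` (journal page = PDF page + 222): p. 239 [PDF 17], p. 247 [PDF 25].  PRINT p. 247: *"Reasoning in the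
same way as in the proof of Proposition 2.2 we obtain Proposition 2.6 … ‖ζ∇GJ‖_α ≤ O(1)(Lʲη)^{1−α}(‖ζ‖_α + |ζ|)e^{−δ₃d(y,y′)}|J| (2.137)"*, the walk (2.141)
with first leg `∇_ν(h_□G_□h_□) = (c′/L^{j₀})(S_νh_□)·(E_(ν,+)G_□)·h_□ + (∇_νh_□)·G_□·h_□` (p38's `…B6GradLegKLevelV1.DV_sandwich_eq`); OUR READING of the Hölder
quotient (1.109) of [4] p. 35 at one pair: the left factor `P_{x,x′} = pairOp x x′` of `…B6HolderPairMemberV1`, with `P_{x,x′}·M_f = f(x′)P_{x,x′} + (f(x) − f(x′))M_{1_x}`.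

CITATION HEADER (lean-in-tree rule) — WHAT IS REPRODUCED.  Phase-2 file of the `lit-balaban` typed skeleton (HOME `run/shared/lean/pub/lit-balaban/`), seat
**p22 gen 26**, free-target (2.137)₁ at k levels (HOME/STATUS TAKING 2026-08-23T22:15Z; r03 NO OBJECTION 22:25Z); SKELETON row **B6.Prop2.6** (cells only;
decls of record untouched).  §1 two cut-off lemmas (an input-localised majorant times a right cut-off `h` supported in `S` is a global majorant with
`1_S(y′)`; with a bounded left multiplier); §2 the prefactor bookkeeping on blocks of level `≤ j₀ + 2`; §3 the four-term operator identity
`pair_sandwich_eq`; §4 **`holderLeg_pair_of_inputs`**: for every cube, pair `(x, x′)` of the same direction whose output block has level `≤ j₀ + 2` and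
satisfies the □̃-placement `y(x′) ∈ □⁺ ⇒ y(x) ∈ □̃`, and every pair of input-localised PAIR majorants
`InMajorant (P_{x,x′}·E_(ν,+)G_□) □⁺ (τ_A·pref·e^{−ρ′d})`, `InMajorant (P_{x,x′}·G_□) □⁺ (τ_C·pref·e^{−ρ′d})`:
`HasMajorant (P_{x,x′}·∇_ν·(h_□G_□h_□)) (1_{□̃}(y)·L²(τ_A + C1F·τ_C + σ·C₀)·(L^{j(y)}|c′|⁻¹)·e^{−min(ρ₀,ρ′)d_T})` — the legs hypothesis of
`…B6Prop26HolderGradKLevelV1.prop26_2137_grad_kLevel_of_legs` up to the instantiation `τ_A = C_H t^α`, `τ_C = C_H t` (`…B6CubeHolderInDecayV1`) and the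
geometric placement of admissible pairs (next file).  Theorems only; no definition, no `def … : Prop`; standard axioms.
HONEST SCOPE. (1) The pair inputs and the □̃-placement are DISPLAYED hypotheses here (discharged for admissible pairs `|x − x′|_∞ ≤ L^{j(y(x))}` by the
window geometry in the sequel); (2) constants `d`-, `L`-, band-dependent, not optimised; (3) V1 torus only; nothing on d = 4 or the continuum; NOT summit
progress.  Unit `lit-balaban-p22` (gen 26), 2026-08-24.
-/

namespace Literature.MathematicalPhysics.QuantumFieldTheory.Balaban1983to89.B6HolderLegPairTermsV1

open Finset
open LatticeFieldCalculus
open B6MultiLevelBoxOperator (N0 bigSide one_le_bigSide)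
open B6MultiLevelTorusOperator (TDomains)
open B6Cover236MultiLevelBlocks (cubes)
open B6Geom246MultiLevelTorus (geomT)
open B8Ineq192MultiLevelTorus (geomT_len)
open B6RandomWalk (HasMajorant hasMajorant_mono hasMajorant_add BlockSupp)
open B6Prop26Gluing (mulOp mulOp_apply ind ind_nonneg ind_le_one ind_of_mem ind_of_not_mem)
open B6GlobalChartV1 (PV toBox blkV1 domT)
open B6SectAOperatorsV1 (BondIdx)
open B6Partition118KLevelFineSizes (C1F C1F_nonneg)
open B6Partition118KLevelFineMixed (C2X C2X_bounds)
open B6Partition118KLevelTorusCentral (one_le_of_four_le)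
open B6Prop26KLevelSkeletonV1 (hB ST mem_ST pref pref_nonneg abs_hB_le_one blkV1_mem_QT_of_hB_ne_zero)
open B6Prop26KLevelSkeletonV2 (SbigT ST_subset_SbigT)
open B6InMajorantTransplant (InMajorant)
open B6CubeWindowV1 (Placed j0 j0_le_level Gl)
open B6Eq292MemberTorusV1 (EC)
open B6CubeInDecayV1 (hGin_cube hEGin_cube)
open B6CubeCoeffSizesV1 (level_le_of_mem_QT)
open B6Prop26KLevelAssemblyV1 (hasMajorant_smul)
open B6GradLegKLevelV1 (shB shB_apply DV DV_apply DV_sandwich_eq blkV1_mem_ST_of_hB_shift_ne_zero abs_hB_shift_sub_le)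
open B6HolderPairMemberV1 (pairOp pairOp_mul_apply pairOp_mul_mulOp)
open B6HBDisplacementLipV1 (abs_hB_sub_le_supDist abs_DV_hB_sub_le_supDist)

/-! ## §1  Input-localised majorants with cut-offs -/

section Cutoff

variable {X : Type} {g : B6.Geometry}

/-- an input-localised majorant on `S` times a RIGHT cut-off `h` supported in the blocks of `S`, `|h| ≤ 1`, is a global majorant with the input
indicator `1_S(y′)`. [cite: Balaban1984PropagatorsII, (2.51) p.232, (2.91) p.239 (supp h_□ ⊂ □⁺), bookkeeping] -/
theorem hasMajorant_mul_mulOp_of_inMajorant (blk : X → g.Site) {T : Module.End ℝ (X → ℝ)} {h : X → ℝ} {S : Set g.Site}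
    {K : g.Site → g.Site → ℝ} (hK : ∀ a b, 0 ≤ K a b) (hhsupp : ∀ x, h x ≠ 0 → blk x ∈ S) (hhle : ∀ x, |h x| ≤ 1)
    (hT : InMajorant blk T S K) : HasMajorant blk (T * mulOp h) (fun a b => ind S b * K a b) := by
  intro y' μ B hμ z
  beta_reduce
  rw [Module.End.mul_apply]
  by_cases hy : y' ∈ S
  · rw [ind_of_mem hy, one_mul]
    refine hT y' hy (mulOp h μ) B ⟨hμ.nonneg, fun x hx => ?_, fun x hx => ?_⟩ z
    · rw [mulOp_apply, abs_mul]
      calc |h x| * |μ x| ≤ 1 * B := mul_le_mul (hhle x) (hμ.bound x hx) (abs_nonneg _) zero_le_one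
        _ = B := one_mul B
    · rw [mulOp_apply, hμ.off x hx, mul_zero]
  · have h0 : mulOp h μ = 0 := by
      funext x
      rw [mulOp_apply, Pi.zero_apply]
      by_cases hx : blk x = y'
      · have : h x = 0 := by
          by_contra hne; exact hy (hx ▸ hhsupp x hne)
        rw [this, zero_mul]
      · rw [hμ.off x hx, mul_zero]
    rw [h0, map_zero, Pi.zero_apply, abs_zero]
    exact mul_nonneg (mul_nonneg (ind_nonneg _ _) (hK _ _)) hμ.nonneg

/-- the same with a bounded LEFT multiplier `|f| ≤ s`. [cite: Balaban1984PropagatorsII, (2.51) p.232, (2.91) p.239, bookkeeping] -/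
theorem hasMajorant_mulOp_mul_mul_mulOp_of_inMajorant (blk : X → g.Site) {T : Module.End ℝ (X → ℝ)} {f h : X → ℝ} {S : Set g.Site}
    {K : g.Site → g.Site → ℝ} {s : ℝ} (hK : ∀ a b, 0 ≤ K a b) (hfle : ∀ x, |f x| ≤ s) (hhsupp : ∀ x, h x ≠ 0 → blk x ∈ S)
    (hhle : ∀ x, |h x| ≤ 1) (hT : InMajorant blk T S K) :
    HasMajorant blk (mulOp f * T * mulOp h) (fun a b => ind S b * (s * K a b)) := by
  have h1 := hasMajorant_mul_mulOp_of_inMajorant blk hK hhsupp hhle hT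
  intro y' μ B hμ z
  beta_reduce
  rw [mul_assoc, Module.End.mul_apply, mulOp_apply, abs_mul]
  have hs : 0 ≤ s := (abs_nonneg _).trans (hfle z)
  calc |f z| * |(T * mulOp h) μ z| ≤ s * (ind S y' * K (blk z) y' * B) :=
        mul_le_mul (hfle z) (h1 y' μ B hμ z) (abs_nonneg _) hs
    _ = ind S y' * (s * K (blk z) y') * B := by ring

end Cutoff

/-! ## §2  The prefactor bookkeeping on blocks of level `≤ j₀ + 2` -/

section Scale

variable {d ℓ : ℕ} {Mh k R : ℕ} {P' : Fin (d + 1) → ℕ}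

/-- pure-real core: `|c′|/J·(Λ/c′)² ≤ L²·(Λ·|c′|⁻¹)` once `Λ ≤ L²J` (p38's `scale_aux`). [folklore] -/
private theorem scale_aux {L Λ J cf : ℝ} (hJ : 0 < J) (hΛ : 0 ≤ Λ) (hcf : cf ≠ 0) (h : Λ ≤ L ^ 2 * J) :
    |cf| / J * (Λ / cf) ^ 2 ≤ L ^ 2 * (Λ * |cf|⁻¹) := by
  have hc : 0 < |cf| := abs_pos.2 hcf
  have e : |cf| / J * (Λ / cf) ^ 2 = Λ / J * (Λ * |cf|⁻¹) := by
    rw [div_pow, show cf ^ 2 = |cf| ^ 2 from (sq_abs cf).symm]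
    field_simp
  rw [e]
  exact mul_le_mul_of_nonneg_right ((div_le_iff₀ hJ).2 h) (by positivity)

/-- **`|c′|/L^{j₀}·(L^{j(y)}/c′)² ≤ L²·(L^{j(y)}·|c′|⁻¹)` ON BLOCKS OF LEVEL `≤ j₀ + 2`** (p38's `pref_scale_le`, level form).
[cite: Balaban1984PropagatorsII, (2.94) p.239, (2.136)–(2.137) p.247 («Lʲη»), bookkeeping] -/
theorem pref_scale_le_of_lev {D : TDomains d ℓ Mh k P' R} {j₀ : ℕ} {cf : ℝ} (hcf : cf ≠ 0) {y : (geomT D).Site} (hlev : y.1.1 ≤ j₀ + 2) :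
    |cf| / (((ℓ + 1 : ℕ) : ℝ)) ^ j₀ * pref cf y ≤ (((ℓ + 1 : ℕ) : ℝ)) ^ 2 * ((geomT D).len y * |cf|⁻¹) := by
  have hL1 : (1 : ℝ) ≤ ((ℓ + 1 : ℕ) : ℝ) := by exact_mod_cast Nat.succ_pos ℓ
  have hpow : (((ℓ + 1 : ℕ) : ℝ)) ^ (y.1.1 : ℕ) ≤ (((ℓ + 1 : ℕ) : ℝ)) ^ 2 * (((ℓ + 1 : ℕ) : ℝ)) ^ j₀ := by
    rw [← pow_add]; exact pow_le_pow_right₀ hL1 (by omega)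
  have elen : (geomT D).len y = (((ℓ + 1 : ℕ) : ℝ)) ^ (y.1.1 : ℕ) := by rw [geomT_len, mul_one]; push_cast; ring
  rw [elen]
  exact scale_aux (by positivity) (by positivity) hcf hpow

/-- `L^{j₀} ≤ 8S/5`, `S = M_h·L^{j(□)+1}` (`j₀ ≤ j(□)`, `M_h ≥ 1`). [cite: Balaban1984PropagatorsII, p.238 (j₀ ≤ j), p.247, bookkeeping] -/
theorem pow_j0_le_S (hL : Odd (ℓ + 1) ∧ 1 < ℓ + 1) {D : TDomains d ℓ Mh k P' R} (hMh1 : 1 ≤ Mh) (hP4 : ∀ μ, 4 ≤ P' μ)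
    (c : ↥(cubes D.toDomains)) (hR2 : 2 * (ℓ + 1) ^ 2 ≤ R) :
    (((ℓ + 1 : ℕ) : ℝ)) ^ j0 hMh1 hP4 c ≤ 8 / 5 * (bigSide ℓ Mh c.1.1 : ℝ) := by
  have hj := (j0_le_level hMh1 hP4 c hL hR2).1
  unfold bigSide; push_cast
  have hL1 : (1 : ℝ) ≤ (ℓ : ℝ) + 1 := by linarith [Nat.cast_nonneg (α := ℝ) ℓ]
  have hM : (1 : ℝ) ≤ Mh := by exact_mod_cast hMh1
  have h1 : ((ℓ : ℝ) + 1) ^ j0 hMh1 hP4 c ≤ ((ℓ : ℝ) + 1) ^ (c.1.1 + 1) := pow_le_pow_right₀ hL1 (by omega)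
  have h2 : ((ℓ : ℝ) + 1) ^ (c.1.1 + 1) ≤ (Mh : ℝ) * ((ℓ : ℝ) + 1) ^ (c.1.1 + 1) := le_mul_of_one_le_left (by positivity) hM
  nlinarith [pow_nonneg (by positivity : (0:ℝ) ≤ (ℓ : ℝ) + 1) (c.1.1 + 1)]

end Scale

/-! ## §3  The four-term identity for `P_{x,x′}·∇_ν·(h_□G_□h_□)` -/

section Cube

variable {d ℓ : ℕ} {hd : 1 ≤ d + 1} {hL : Odd (ℓ + 1) ∧ 1 < ℓ + 1} {a₀ a₁ : ℝ} {m K : ℕ} {Mh k R : ℕ} {P' : Fin (d + 1) → ℕ}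
variable (hN : ∀ μ, N0 ℓ Mh k P' μ = (PV d ℓ m K hd hL).sitesPerDir 0) {D : TDomains d ℓ Mh k P' R} (hk : k ≤ m + K)
  (hMh1 : 1 ≤ Mh) (hP4 : ∀ μ, 4 ≤ P' μ) {a : ℕ} (hMha : Mh = (ℓ + 1) ^ a) (c : ↥(cubes D.toDomains)) (ha : a₀ ≤ a₁)

include hMha in
/-- **THE FOUR-TERM IDENTITY**: `P_{x,x′}·∇_ν·(h_□G_□h_□) = (κ·(S_νh)(x′))•(P_{x,x′}·E G_□·h_□) + (κ·((S_νh)(x) − (S_νh)(x′)))•(M_{1_x}·E G_□·h_□)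
+ ((∇_νh)(x′))•(P_{x,x′}·G_□·h_□) + ((∇_νh)(x) − (∇_νh)(x′))•(M_{1_x}·G_□·h_□)`, `κ = c′/L^{j₀}` (the product rule at two points).
[cite: Balaban1984PropagatorsII, (2.141) p.247 (first leg), (2.92) p.239 line 1, (2.137) p.247; Balaban1984PropagatorsI, (1.109) p.35] -/
theorem pair_sandwich_eq (hM8 : 8 ≤ Mh) (hR2 : 2 * (ℓ + 1) ^ 2 ≤ R) (hpl : Placed ℓ k P' c.1) (w : BondIdx (domT hN D hk) → ℝ) {cf : ℝ}
    (hcf : cf ≠ 0) (ν : Fin (d + 1)) (x x' : PBond (PV d ℓ m K hd hL) 0) :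
    pairOp x x' * DV ν cf * (mulOp (hB hN D c) * Gl hN hk hMh1 hP4 hMha c ha hpl w cf * mulOp (hB hN D c)) =
      (cf / (((ℓ + 1 : ℕ) : ℝ)) ^ j0 hMh1 hP4 c * shB ν (hB hN D c) x') •
          (pairOp x x' * (EC hN hk hMh1 hP4 hMha c ha hpl w cf (ν, true) * Gl hN hk hMh1 hP4 hMha c ha hpl w cf) * mulOp (hB hN D c)) +
        (cf / (((ℓ + 1 : ℕ) : ℝ)) ^ j0 hMh1 hP4 c * (shB ν (hB hN D c) x - shB ν (hB hN D c) x')) •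
          (mulOp (Pi.single x (1 : ℝ)) * (EC hN hk hMh1 hP4 hMha c ha hpl w cf (ν, true) * Gl hN hk hMh1 hP4 hMha c ha hpl w cf) *
            mulOp (hB hN D c)) +
        (DV ν cf (hB hN D c) x') • (pairOp x x' * Gl hN hk hMh1 hP4 hMha c ha hpl w cf * mulOp (hB hN D c)) +
        (DV ν cf (hB hN D c) x - DV ν cf (hB hN D c) x') •
          (mulOp (Pi.single x (1 : ℝ)) * Gl hN hk hMh1 hP4 hMha c ha hpl w cf * mulOp (hB hN D c)) := by
  rw [mul_assoc (pairOp x x'), DV_sandwich_eq hN hk hMh1 hP4 hMha c ha hM8 hR2 hpl w hcf ν]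
  generalize EC hN hk hMh1 hP4 hMha c ha hpl w cf (ν, true) * Gl hN hk hMh1 hP4 hMha c ha hpl w cf = EG
  generalize Gl hN hk hMh1 hP4 hMha c ha hpl w cf = G
  generalize mulOp (hB hN D c) = Hm
  set κ : ℝ := cf / (((ℓ + 1 : ℕ) : ℝ)) ^ j0 hMh1 hP4 c with hκ
  have h1 := pairOp_mul_mulOp x x' (shB ν (hB hN D c))
  have h2 := pairOp_mul_mulOp x x' (DV ν cf (hB hN D c))
  generalize mulOp (shB ν (hB hN D c)) = F1 at h1 ⊢
  generalize mulOp (DV ν cf (hB hN D c)) = F2 at h2 ⊢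
  generalize pairOp x x' = Pp at h1 h2 ⊢
  generalize mulOp (Pi.single x (1 : ℝ)) = Q at h1 h2 ⊢
  rw [mul_add, mul_smul_comm, show Pp * (F1 * EG * Hm) = (Pp * F1) * EG * Hm by simp only [mul_assoc],
    show Pp * (F2 * G * Hm) = (Pp * F2) * G * Hm by simp only [mul_assoc], h1, h2]
  simp only [add_mul, smul_mul_assoc, smul_add, smul_smul]
  simp only [mul_assoc, add_assoc]

end Cube

/-! ## §4  The Hölder first leg of (2.141) from the pair inputs -/

section Leg

/-- `|x + e_λ − (x′ + e_λ)|_∞ = |x − x′|_∞` on a torus. [folklore] -/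
private theorem supDist_shift_shift {P : Params} (x x' : Site P 0) (lam : Fin P.d) :
    supDist (x.shift lam) (x'.shift lam) = supDist x x' := by
  rw [B3TorusRadialSums.supDist_eq_sup_cdist, B3TorusRadialSums.supDist_eq_sup_cdist]
  congr 1
  funext μ
  by_cases h : μ = lam
  · subst h; simp [Site.shift]
  · simp [Site.shift, Function.update_of_ne h]


variable {d ℓ : ℕ} {hd : 1 ≤ d + 1} {hL : Odd (ℓ + 1) ∧ 1 < ℓ + 1} {m K : ℕ} {Mh k R : ℕ} {P' : Fin (d + 1) → ℕ}

/-- one term of the kernel comparison: `|a|·(i·(q·e)) ≤ A·(q·E)` for `|a| ≤ A`, `0 ≤ i ≤ 1`, `q ≥ 0`, `0 ≤ e ≤ E`. [folklore] -/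
private theorem term_le {a A i q e E : ℝ} (ha : |a| ≤ A) (hi0 : 0 ≤ i) (hi1 : i ≤ 1) (hq : 0 ≤ q) (he0 : 0 ≤ e) (he : e ≤ E) :
    |a| * (i * (q * e)) ≤ A * (q * E) := by
  have hA : 0 ≤ A := (abs_nonneg a).trans ha
  calc |a| * (i * (q * e)) ≤ A * (1 * (q * E)) :=
        mul_le_mul ha (mul_le_mul hi1 (mul_le_mul_of_nonneg_left he hq) (by positivity) zero_le_one) (by positivity) hA
    _ = A * (q * E) := by ring

open Classical in
/-- **THE HÖLDER FIRST LEG OF (2.141) FOR `∇_νG`, PER CUBE, FROM THE PAIR INPUTS** (`L ≥ 5`): there are `ρ₀ > 0`, `C₀ ≥ 0` (on `d, L` and the weight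
band only) such that on every admissible V1 torus (`M_h = Lᵃ ≥ 8`, `R ≥ 2L²`, `P′ ≥ 5`, cube placed), for every `c′ ≠ 0`, weights, direction `ν`, cube `□`,
pair of fine bonds `x, x′` of the same direction with `lev y(x) ≤ j₀(□) + 2` and the □̃-placement `y(x′) ∈ □⁺ ⇒ y(x) ∈ □̃`, every `τ_A, τ_C ≥ 0`,
`ρ′ > 0` and pair inputs `InMajorant (P_{x,x′}·E_(ν,+)G_□) □⁺ (τ_A·pref·e^{−ρ′d})`, `InMajorant (P_{x,x′}·G_□) □⁺ (τ_C·pref·e^{−ρ′d})`: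
`HasMajorant (P_{x,x′}·∇_ν·(h_□G_□h_□)) (1_{□̃}(y)·L²(τ_A + C1F·τ_C + σ·C₀)·(L^{j(y)}|c′|⁻¹)·e^{−min(ρ₀,ρ′)d_T(y,y′)})`,
`σ = (d+1)|x − x′|_∞/(8S_□/5)` — print's `O(1)(Lʲη)^{1−α}|x − x′|^α e^{−δd}` for the first leg once `τ_A = C_H t^α`, `τ_C = C_H t`.
[cite: Balaban1984PropagatorsII, Prop. 2.6 (2.137) p.247, (2.141) p.247, (2.133) p.247, (2.92) p.239 line 1; Balaban1984PropagatorsI, (1.109) p.35] -/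
theorem holderLeg_pair_of_inputs (d ℓ : ℕ) (hd : 1 ≤ d + 1) (hL : Odd (ℓ + 1) ∧ 1 < ℓ + 1) {a₀ a₁ : ℝ} (ha₀ : 0 < a₀) (ha₁ : a₀ ≤ a₁) :
    ∃ ρ₀ : ℝ, 0 < ρ₀ ∧ ∃ C₀ : ℝ, 0 ≤ C₀ ∧ ∀ (m K : ℕ) {Mh k R : ℕ} {P' : Fin (d + 1) → ℕ}
      (hN : ∀ μ, N0 ℓ Mh k P' μ = (PV d ℓ m K hd hL).sitesPerDir 0) (D : TDomains d ℓ Mh k P' R) (hk : k ≤ m + K)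
      (hMh1 : 1 ≤ Mh) (hP4 : ∀ μ, 4 ≤ P' μ) {a : ℕ} (hMha : Mh = (ℓ + 1) ^ a) (_ : 8 ≤ Mh) (_ : 2 * (ℓ + 1) ^ 2 ≤ R) (_ : ∀ μ, 5 ≤ P' μ)
      (_ : 4 ≤ ℓ) (c : ↥(cubes D.toDomains)) (hpl : Placed ℓ k P' c.1) (w : BondIdx (domT hN D hk) → ℝ) {cf : ℝ} (_ : cf ≠ 0) (ν : Fin (d + 1))
      (x x' : PBond (PV d ℓ m K hd hL) 0) (_ : x.dir = x'.dir) (_ : (blkV1 hN D x).1.1 ≤ j0 hMh1 hP4 c + 2)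
      (_ : blkV1 hN D x' ∈ ST D hMh1 hP4 c → blkV1 hN D x ∈ SbigT D hMh1 hP4 c)
      (τA τC ρ' : ℝ), 0 ≤ τA → 0 ≤ τC → 0 < ρ' →
      InMajorant (g := geomT D) (blkV1 hN D)
        (pairOp x x' * (EC hN hk hMh1 hP4 hMha c ha₁ hpl w cf (ν, true) * Gl hN hk hMh1 hP4 hMha c ha₁ hpl w cf)) (ST D hMh1 hP4 c)
        (fun y y' => τA * pref cf y * Real.exp (-(ρ' * (geomT D).dist y y'))) →
      InMajorant (g := geomT D) (blkV1 hN D) (pairOp x x' * Gl hN hk hMh1 hP4 hMha c ha₁ hpl w cf) (ST D hMh1 hP4 c)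
        (fun y y' => τC * pref cf y * Real.exp (-(ρ' * (geomT D).dist y y'))) →
      HasMajorant (g := geomT D) (blkV1 hN D)
        (pairOp x x' * DV ν cf * (mulOp (hB hN D c) * Gl hN hk hMh1 hP4 hMha c ha₁ hpl w cf * mulOp (hB hN D c)))
        (fun y y' => ind (SbigT D hMh1 hP4 c) y *
          ((((ℓ + 1 : ℕ) : ℝ)) ^ 2 * (τA + C1F d ℓ * τC +
              ((d : ℝ) + 1) * ((supDist x.src x'.src : ℕ) : ℝ) / (8 / 5 * (bigSide ℓ Mh c.1.1 : ℝ)) * C₀) *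
            ((geomT D).len y * |cf|⁻¹) * Real.exp (-(min ρ₀ ρ' * (geomT D).dist y y')))) := by
  obtain ⟨ρG, hρG, CG, hCG, hGin⟩ := hGin_cube d ℓ hd hL ha₀ ha₁
  obtain ⟨ρE, hρE, CE, hCE, hEGin⟩ := hEGin_cube d ℓ hd hL ha₀ ha₁
  have hC1 := C1F_nonneg d ℓ; have hC2 := (C2X_bounds d ℓ).2.2
  refine ⟨min ρG ρE, lt_min hρG hρE, C1F d ℓ * CE + C2X d ℓ * CG, by positivity, ?_⟩
  intro m K Mh k R P' hN D hk hMh1 hP4 a hMha hM8 hR2 hP5 hℓ c hpl w cf hcf ν x x' hdir hlev hgeo τA τC ρ' hτA hτC hρ' hA hC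
  have hMh : 2 ≤ Mh := le_trans (by norm_num) hM8
  have hR : 2 * (ℓ + 1) ≤ R := le_trans (by nlinarith : 2 * (ℓ + 1) ≤ 2 * (ℓ + 1) ^ 2) hR2
  have hP : ∀ μ, 1 ≤ P' μ := one_le_of_four_le hP4
  have hdnn : ∀ y y' : (geomT D).Site, 0 ≤ (geomT D).dist y y' := fun _ _ => Nat.cast_nonneg _
  have hS0 : (0 : ℝ) < 8 / 5 * (bigSide ℓ Mh c.1.1 : ℝ) := by have := one_le_bigSide hMh1 (ℓ := ℓ) c.1.1; positivity
  set Λ : ℝ := ((ℓ + 1 : ℕ) : ℝ) with hΛ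
  set J : ℝ := Λ ^ j0 hMh1 hP4 c with hJ
  have hJ0 : 0 < J := by positivity
  set Sf : ℝ := 8 / 5 * (bigSide ℓ Mh c.1.1 : ℝ) with hSf
  set sD : ℝ := ((d : ℝ) + 1) * ((supDist x.src x'.src : ℕ) : ℝ) with hsD
  have hsD0 : 0 ≤ sD := by positivity
  set h := hB hN D c with hh
  -- support and size facts of `h_□`
  have hsupp0 : ∀ b : PBond (PV d ℓ m K hd hL) 0, h b ≠ 0 → blkV1 hN D b ∈ ST D hMh1 hP4 c :=
    fun b hb => (mem_ST D hMh1 hP4 c _).2 (blkV1_mem_QT_of_hB_ne_zero hN D hMh hR hP4 c hb)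
  have hsupp1 : ∀ b : PBond (PV d ℓ m K hd hL) 0, shB ν h b ≠ 0 → blkV1 hN D b ∈ ST D hMh1 hP4 c :=
    fun b hb => blkV1_mem_ST_of_hB_shift_ne_zero hN hMh1 hP4 c hM8 hR hP5 ν (by rw [shB_apply, hh] at hb; exact hb)
  have hle1 : ∀ b : PBond (PV d ℓ m K hd hL) 0, |h b| ≤ 1 := fun b => abs_hB_le_one hN D hMh1 hP c b
  -- the single-point input-localised legs of the member
  have hE := hEGin m K hN D hk hMh1 hP4 hMha hMh hR2 hℓ c hpl w cf (ν, true)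
  have hG := hGin m K hN D hk hMh1 hP4 hMha hMh hR2 hℓ c hpl w cf
  -- the four majorants
  have hTA := hasMajorant_mul_mulOp_of_inMajorant (g := geomT D) (blkV1 hN D)
    (fun y y' => by have := pref_nonneg cf y; positivity) hsupp0 hle1 hA
  have hTB := hasMajorant_mulOp_mul_mul_mulOp_of_inMajorant (g := geomT D) (blkV1 hN D) (f := Pi.single x (1 : ℝ)) (s := 1)
    (fun y y' => by have := pref_nonneg cf y; positivity)
    (fun b => by rw [Pi.single_apply]; split_ifs <;> simp) hsupp0 hle1 hE
  have hTC := hasMajorant_mul_mulOp_of_inMajorant (g := geomT D) (blkV1 hN D)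
    (fun y y' => by have := pref_nonneg cf y; positivity) hsupp0 hle1 hC
  have hTD := hasMajorant_mulOp_mul_mul_mulOp_of_inMajorant (g := geomT D) (blkV1 hN D) (f := Pi.single x (1 : ℝ)) (s := 1)
    (fun y y' => by have := pref_nonneg cf y; positivity)
    (fun b => by rw [Pi.single_apply]; split_ifs <;> simp) hsupp0 hle1 hG
  -- the four scalar coefficients
  have hκ : |cf / J| = |cf| / J := by rw [abs_div, abs_of_pos hJ0]
  have hcA : |cf / J * shB ν h x'| ≤ |cf| / J := by
    rw [abs_mul, hκ]; exact (mul_le_mul_of_nonneg_left (by rw [shB_apply]; exact hle1 _) (by positivity)).trans (mul_one _).le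
  have hcB : |cf / J * (shB ν h x - shB ν h x')| ≤ |cf| / J * (sD * (C1F d ℓ / Sf)) := by
    rw [abs_mul, hκ]
    refine mul_le_mul_of_nonneg_left ?_ (by positivity)
    rw [shB_apply, shB_apply]
    have h1 := abs_hB_sub_le_supDist hN D c hMh hR hP5 (x := ⟨x.src.shift ν, x.dir⟩) (x' := ⟨x'.src.shift ν, x'.dir⟩) hdir
    rw [supDist_shift_shift] at h1
    simpa only [hsD, hSf, hh] using h1
  have hinvJS : 1 / Sf ≤ 1 / J := one_div_le_one_div_of_le hJ0 (by rw [hJ, hSf, hΛ]; exact pow_j0_le_S hL hMh1 hP4 c hR2)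
  have hcC : |DV ν cf h x'| ≤ |cf| / J * C1F d ℓ := by
    rw [DV_apply, abs_mul]
    have h1 := abs_hB_shift_sub_le hN c hMh hR hP5 ν x'
    calc |cf| * |h ⟨x'.src.shift ν, x'.dir⟩ - h x'| ≤ |cf| * (C1F d ℓ / Sf) := mul_le_mul_of_nonneg_left (by simpa only [hh, hSf] using h1) (abs_nonneg _)
      _ = |cf| * C1F d ℓ * (1 / Sf) := by ring
      _ ≤ |cf| * C1F d ℓ * (1 / J) := mul_le_mul_of_nonneg_left hinvJS (by positivity)
      _ = |cf| / J * C1F d ℓ := by ring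
  have hcD : |DV ν cf h x - DV ν cf h x'| ≤ |cf| / J * (sD * (C2X d ℓ / Sf)) := by
    have h1 := abs_DV_hB_sub_le_supDist hN D c hMh hR hP5 ν cf hdir
    calc |DV ν cf h x - DV ν cf h x'| ≤ |cf| * (sD * (C2X d ℓ / Sf ^ 2)) := by simpa only [hh, hsD, hSf] using h1
      _ = |cf| * (sD * (C2X d ℓ / Sf)) * (1 / Sf) := by rw [hSf]; field_simp
      _ ≤ |cf| * (sD * (C2X d ℓ / Sf)) * (1 / J) := mul_le_mul_of_nonneg_left hinvJS (by positivity)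
      _ = |cf| / J * (sD * (C2X d ℓ / Sf)) := by ring
  -- the majorant of the sum of the four scaled terms
  have hsum := hasMajorant_add _ (hasMajorant_add _ (hasMajorant_add _ (hasMajorant_smul (g := geomT D) (blkV1 hN D) hTA (cf / J * shB ν h x'))
    (hasMajorant_smul (g := geomT D) (blkV1 hN D) hTB (cf / J * (shB ν h x - shB ν h x'))))
    (hasMajorant_smul (g := geomT D) (blkV1 hN D) hTC (DV ν cf h x')))
    (hasMajorant_smul (g := geomT D) (blkV1 hN D) hTD (DV ν cf h x - DV ν cf h x'))
  rw [← pair_sandwich_eq hN hk hMh1 hP4 hMha c ha₁ hM8 hR2 hpl w hcf ν x x'] at hsum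
  -- pointwise: the output of `P_{x,x′}·T` is `x`
  intro y' μ B hμ z
  beta_reduce
  have hB := hμ.nonneg
  set W := mulOp h * Gl hN hk hMh1 hP4 hMha c ha₁ hpl w cf * mulOp h with hW
  have hentry : (pairOp x x' * DV (P := PV d ℓ m K hd hL) ν cf * W) μ z =
      if z = x then (DV (P := PV d ℓ m K hd hL) ν cf * W) μ x - (DV (P := PV d ℓ m K hd hL) ν cf * W) μ x' else 0 := by
    rw [mul_assoc, pairOp_mul_apply]
  have hρle' : min (min ρG ρE) ρ' ≤ ρ' := min_le_right _ _
  have hρleE : min (min ρG ρE) ρ' ≤ ρE := (min_le_left _ _).trans (min_le_right _ _)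
  have hρleG : min (min ρG ρE) ρ' ≤ ρG := (min_le_left _ _).trans (min_le_left _ _)
  have hexp : ∀ {r : ℝ}, min (min ρG ρE) ρ' ≤ r → ∀ t : ℝ, 0 ≤ t →
      Real.exp (-(r * t)) ≤ Real.exp (-(min (min ρG ρE) ρ' * t)) :=
    fun hr t ht => Real.exp_le_exp.mpr (neg_le_neg (mul_le_mul_of_nonneg_right hr ht))
  have hKnn : 0 ≤ ind (SbigT D hMh1 hP4 c) (blkV1 hN D z) *
      (Λ ^ 2 * (τA + C1F d ℓ * τC + sD / Sf * (C1F d ℓ * CE + C2X d ℓ * CG)) * ((geomT D).len (blkV1 hN D z) * |cf|⁻¹) *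
        Real.exp (-(min (min ρG ρE) ρ' * (geomT D).dist (blkV1 hN D z) y'))) * B := by
    have := ind_nonneg (SbigT D hMh1 hP4 c) (blkV1 hN D z)
    have : 0 ≤ (geomT D).len (blkV1 hN D z) * |cf|⁻¹ := by rw [geomT_len]; positivity
    positivity
  have eσ : ((d : ℝ) + 1) * ((supDist x.src x'.src : ℕ) : ℝ) / (8 / 5 * (bigSide ℓ Mh c.1.1 : ℝ)) = sD / Sf := by rw [hsD, hSf]
  rw [eσ]
  by_cases hz : z = x
  · subst hz
    by_cases hxS : blkV1 hN D z ∈ SbigT D hMh1 hP4 c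
    · rw [ind_of_mem hxS, one_mul]
      simp only [one_mul] at hsum
      refine (hsum y' μ B hμ z).trans ?_
      -- compare the kernels at the output block `y(x)`
      have hd0 : 0 ≤ (geomT D).dist (blkV1 hN D z) y' := hdnn _ _
      have hp0 : 0 ≤ pref cf (blkV1 hN D z) := pref_nonneg cf _
      have hi1 : ind (ST D hMh1 hP4 c) y' ≤ 1 := ind_le_one _ _
      have hi0 : 0 ≤ ind (ST D hMh1 hP4 c) y' := ind_nonneg _ _
      have t1 := term_le hcA hi0 hi1 (mul_nonneg hτA hp0) (Real.exp_nonneg _) (hexp hρle' _ hd0)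
      have t2 := term_le hcB hi0 hi1 (mul_nonneg hCE hp0) (Real.exp_nonneg _) (hexp hρleE _ hd0)
      have t3 := term_le hcC hi0 hi1 (mul_nonneg hτC hp0) (Real.exp_nonneg _) (hexp hρle' _ hd0)
      have t4 := term_le hcD hi0 hi1 (mul_nonneg hCG hp0) (Real.exp_nonneg _) (hexp hρleG _ hd0)
      have hps : |cf| / J * pref cf (blkV1 hN D z) ≤ Λ ^ 2 * ((geomT D).len (blkV1 hN D z) * |cf|⁻¹) := by
        rw [hJ, hΛ]; exact pref_scale_le_of_lev hcf hlev
      have heρ0 : 0 ≤ Real.exp (-(min (min ρG ρE) ρ' * (geomT D).dist (blkV1 hN D z) y')) := Real.exp_nonneg _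
      have hco : 0 ≤ τA + sD * (C1F d ℓ / Sf) * CE + C1F d ℓ * τC + sD * (C2X d ℓ / Sf) * CG := by positivity
      beta_reduce
      generalize Real.exp (-(min (min ρG ρE) ρ' * (geomT D).dist (blkV1 hN D z) y')) = eρ at t1 t2 t3 t4 heρ0 ⊢
      generalize Real.exp (-(ρ' * (geomT D).dist (blkV1 hN D z) y')) = e' at t1 t3 ⊢
      generalize Real.exp (-(ρE * (geomT D).dist (blkV1 hN D z) y')) = eE at t2 ⊢
      generalize Real.exp (-(ρG * (geomT D).dist (blkV1 hN D z) y')) = eG at t4 ⊢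
      generalize pref cf (blkV1 hN D z) = p at t1 t2 t3 t4 hps ⊢
      generalize (geomT D).len (blkV1 hN D z) * |cf|⁻¹ = Lc at hps ⊢
      generalize ind (ST D hMh1 hP4 c) y' = i at t1 t2 t3 t4 ⊢
      generalize |cf / J * shB ν h x'| = a1 at t1 ⊢
      generalize |cf / J * (shB ν h z - shB ν h x')| = a2 at t2 ⊢
      generalize |DV ν cf h x'| = a3 at t3 ⊢
      generalize |DV ν cf h z - DV ν cf h x'| = a4 at t4 ⊢
      calc (a1 * (i * (τA * p * e')) + a2 * (i * (CE * p * eE)) + a3 * (i * (τC * p * e')) + a4 * (i * (CG * p * eG))) * B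
          ≤ (|cf| / J * (τA * p * eρ) + |cf| / J * (sD * (C1F d ℓ / Sf)) * (CE * p * eρ) + |cf| / J * C1F d ℓ * (τC * p * eρ) +
              |cf| / J * (sD * (C2X d ℓ / Sf)) * (CG * p * eρ)) * B :=
            mul_le_mul_of_nonneg_right (add_le_add (add_le_add (add_le_add t1 t2) t3) t4) hB
        _ = (|cf| / J * p) * (τA + sD * (C1F d ℓ / Sf) * CE + C1F d ℓ * τC + sD * (C2X d ℓ / Sf) * CG) * eρ * B := by ring
        _ ≤ (Λ ^ 2 * Lc) * (τA + sD * (C1F d ℓ / Sf) * CE + C1F d ℓ * τC + sD * (C2X d ℓ / Sf) * CG) * eρ * B :=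
            mul_le_mul_of_nonneg_right (mul_le_mul_of_nonneg_right (mul_le_mul_of_nonneg_right hps hco) heρ0) hB
        _ = Λ ^ 2 * (τA + C1F d ℓ * τC + sD / Sf * (C1F d ℓ * CE + C2X d ℓ * CG)) * Lc * eρ * B := by
            rw [hSf]; field_simp; ring
    · -- `y(x) ∉ □̃`: both `x` and `x′` are off `supp h_□` and `supp S_νh_□`, the entry vanishes
      have hx0 : h z = 0 := by
        by_contra hne; exact hxS (ST_subset_SbigT D hMh1 hP4 c (hsupp0 z hne))
      have hx1 : h ⟨z.src.shift ν, z.dir⟩ = 0 := by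
        by_contra hne; exact hxS (ST_subset_SbigT D hMh1 hP4 c (hsupp1 z (by rw [shB_apply]; exact hne)))
      have hx0' : h x' = 0 := by
        by_contra hne; exact hxS (hgeo (hsupp0 x' hne))
      have hx1' : h ⟨x'.src.shift ν, x'.dir⟩ = 0 := by
        by_contra hne; exact hxS (hgeo (hsupp1 x' (by rw [shB_apply]; exact hne)))
      have hv : ∀ b : PBond (PV d ℓ m K hd hL) 0, h b = 0 → h ⟨b.src.shift ν, b.dir⟩ = 0 →
          (DV (P := PV d ℓ m K hd hL) ν cf * W) μ b = 0 := by
        intro b h0 h1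
        rw [Module.End.mul_apply, DV_apply, hW, Module.End.mul_apply, Module.End.mul_apply, mulOp_apply, mulOp_apply, h0, h1]
        ring
      rw [hentry, if_pos rfl, hv z hx0 hx1, hv x' hx0' hx1', sub_zero, abs_zero]
      exact hKnn
  · rw [hentry, if_neg hz, abs_zero]
    exact hKnn

end Leg

end Literature.MathematicalPhysics.QuantumFieldTheory.Balaban1983to89.B6HolderLegPairTermsV1
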